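import Mathlib
import Literature.MathematicalPhysics.QuantumFieldTheory.Balaban1983to89.B9SectDFP

/-! # `Balaban1983to89.B9Eq3152` — B9 pp. 421, 425–426: (3.151)–(3.152) `RD*G₁ = RG′D*`, `G₁DR = DG′R`, p. 425
# `RD*G₁DR = R`, and (3.128)–(3.129) — DERIVED for every propagator of the Sect.-D shape `G⁻¹ = Δ_π + DRD* + Q*aQ`
# from the action of `G⁻¹` on the pure gauge modes `Dλ`, `λ ∈ N(Q′)`; the operator hypothesis `h3151` of [g13's]
# `B9SectECov` §8–§9 and the ring hypotheses of [r1's] `B9.lean` Sect. D algebra DISCHARGED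

CITATION HEADER.  Unit `b2b-balaban-b09` (gen 14, cell pub-balaban), PAPER SUB-CELL B09 =
T. Balaban, *Propagators for lattice gauge theories in a background field*, Commun. Math. Phys. **99** (1985) 389–434
[`Balaban1985BackgroundPropagators`] (= B9).  p. 421 [PDF 33], p. 425 [PDF 37], p. 426 [PDF 38] (renders
`1985-cmp99-background-propagators-p033-x2.png`, `…-p037-x2.png`, `…-p038-x2.png`, READ AS IMAGES — the Euclid text
layer is unreliable), verbatim:
p. 421: *"Let us write a quadratic form replacing (3.109) in the variational problem. A → ½⟨A,ΔA⟩ − ⟨HC^{(2)}(A),J⟩. (3.127)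
The function C^{(2)}(A) is defined at bonds of 𝔅, and on Λ_j it coincides with C_j^{(2)}(L^jηA)—a second order term in the
expansion of Q_j(ηA). … We solve the variational problem (3.127), (3.110) in exactly the same way as the problem (3.109),
(3.110). At first we construct a gauge invariant extension of the form on the right-hand side of (3.127) by the formulas
(3.118), (3.119), and next we repeat the calculations in (3.121)–(3.125). Let us denote the operator defined by the problem
(3.127), (3.110) by H₁, and by G₁ the operator defined by the quadratic form
⟨A,G₁⁻¹A⟩ = ⟨A,Δ_πA⟩ − 2⟨HC_π^{(2)}(A),J⟩ + ‖RD\*A‖² + a‖QA‖²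
 = ⟨A − DG′RD\*A, Δ(A − DG′RD\*A)⟩ − 2⟨HC^{(2)}(A − DG′RD\*A),J⟩ + ‖RD\*A‖² + a‖QA‖². (3.128)
Then we have the formula H₁B = G₁Q\*(QG₁Q\*)⁻¹B. (3.129)"*
p. 425: *"𝔓 = I − G₁Q\*(QG₁Q\*)⁻¹Q − G₁DRD\*. (3.147) It is easy to verify explicitly properties of the operator 𝔓, i.e. Q𝔓 = 0,
RD\*𝔓 = 0, 𝔓² = 𝔓, … Verifying the above properties we need to know only the identities (3.124) and RD\*G₁DR = R. The last
can be proved by the same method as used in the proof of (3.124), and in the proof of the same identity in (2.30) [4]."* …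
*"Let us derive more identities. We have
RD\*G₁J = Z⁻¹(J)∫dA exp[−½⟨A,G₁⁻¹A⟩ + ⟨A,J⟩]RD\*A
 = Z⁻¹(J)|det(Δ↾_{N(Q′)})|∫dA δ_R(RD\*A)exp[−½⟨A,G₁⁻¹A⟩ + ⟨A,J⟩] · ∫dλ δ(Q′λ)exp[−½‖Δλ‖² + ⟨Dλ,J⟩]Δλ
 = Δ𝒢D\*J, (3.151)"*
p. 426: *"where 𝒢 is a covariance of the last Gaussian integral in λ. Let us notice that 𝒢 is also a covariance of the
integral (3.17) defining the operator R, and from this integral we get R = Δ𝒢Δ. It is the formula (2.26) in [4], and we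
have also the formula (2.27): 𝒢 = G′² − G′²Q′\*(Q′G′²Q′\*)⁻¹Q′G′². It can be easily proved by the usual Lagrange function
argument. From these identities we get Q′𝒢 = 𝒢Q′\* = 0 and Δ𝒢D\*J = Δ𝒢(Δ + Q′\*aQ′)G′D\*J = Δ𝒢ΔG′D\*J = RG′D\*J, hence
(3.151) gives RD\*G₁ = RG′D\*, and G₁DR = DG′R. (3.152) Let us notice that these identities imply the identities (3.124),
because QG₁DR = QDG′R = D¹Q′G′R = 0."*

THE POINT.  [g13's] `B9SectECov` §8–§9 (v1.2–v1.3) certified p. 426 L1–9 and every hypothesis of [r1's] `B9.lean`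
Sect. D ring algebra (`frakP_of_3146`, `q_mul_frakP`, `rds_mul_frakP`, `frakG_3150`, `frakG_3153`: "(3.124) for `G₁`",
"`RD*G₁DR = R`") for the explicit projection (3.25) — but FROM (3.151) read as the OPERATOR HYPOTHESIS
`h3151 : RD*G₁ = Δ𝒢D*` (`B9SectECov.eq_3152_of_3151`, `sectD_hypotheses_of_3151`), whose printed proof is the
Faddeev–Popov manipulation in the middle members of (3.151) (C-B9-57 (i), not reproduced).  [This lineage's] `B9SectDFP`
(p189066) has since typed Sect. D's own objects: `T = 1 − DG′RD*` (`tOp`), `Δ_π = TᵀKT` (`piOp`),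
`G⁻¹ = Δ_π + DRD* + a·Q_bᵀQ_b` (`Ginv`).  THIS FILE closes the loop WITHOUT (3.151)'s Gaussian route: for EVERY propagator of
that shape — (3.122)'s `G` (bond form `K`), (3.128)'s `G₁` (bond form `K − 2𝒞_J`, §3), any bond form whatsoever, symmetric
or not — the operator `G⁻¹` maps a pure gauge mode `Dλ`, `λ ∈ N(Q′)`, to `DΔλ` (§1: `Δ_π` kills `Dλ` — [this lineage's]
`B9SectDFP.piOp_mul_gauge`; `Q_bDλ = D̄Q′λ = 0` — (3.115); `DRD*Dλ = DRΔλ = DΔλ` — `RΔ = Δ` on `N(Q′)`), hence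
`G·DΔN = DN` and `NᵀΔD*·G = NᵀD*`; composing with the kernel-basis form `R = ΔN(NᵀΔ²N)⁻¹NᵀΔ` ([g13's]
`R_eq_kernelBasis`) and `𝒢 = N(NᵀΔ²N)⁻¹Nᵀ` ([an2's] `Beta.CompositionSingular.blocks_eq_kernelBasis`) gives (3.151) AS AN
OPERATOR IDENTITY `RD*G = Δ𝒢D*` (§2 `eq_3151_op`) — LITERALLY the statement of `h3151` — and both lines of (3.152)
(`eq_3152`).  Fed BY NAME into [g13's] `sectD_hypotheses_of_3151` this yields (3.152), "(3.124) for `G₁`" and both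
`R`-identities HYPOTHESIS-FREE (`sectD_hypotheses`, `sectD_hypotheses_G1`), i.e. [r1's] ring hypotheses are theorems for the
paper's operators.  §4 then recovers (3.151) at the MEASURE level as printed: the `RD*`-moment of the tilted `G⁻¹`-Gaussian is
`Z(J)·Δ𝒢D*J` ([g13's] tilted-Gaussian mean `integral_exp_source_smul` + §2), and `RD*GJ = Z⁻¹(J)∫dA e^{…}RD*A = Δ𝒢D*J`.

WHAT THIS FILE CERTIFIES (kernel; finite index types as in `B9SectDFP`: `n` sites (`Δ = D*D`, `Q′ : m × n` with kernel
basis `N : n × τ`, `Q′N = 0`, `n ≃ τ ⊕ m`), `b` bonds (bond forms `K`, `C : b × b`, `D : b × n`, `DᵀD = Δ`), `q` rows of the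
bond averaging `Q_b` (`Q_bD = D̄Q′`, (3.115)); `R`, `G′`, `Δ′`, `M′` = [adv1's] `B9H163.R/.G'/.Δ'/.M'`; `𝒢 = flucCov (Δ*Δ) Q′`
= [an2's] `Beta.CompositionSingular.flucCov`; `G := (B9SectDFP.Ginv K Δ Q′ a D Q_b a_b)⁻¹`):
1. §1 PURE GAUGE MODES: `Ginv_mul_gauge` (`G⁻¹·DN = DΔN`, no symmetry of `K` or `Δ` used), `G_mul_DΔN` (`G·DΔN = DN`),
   `gauge_transpose_mul_Ginv` (`(DN)ᵀG⁻¹ = NᵀΔD*`, symmetric `Δ`), `NtΔDt_mul_G` (`NᵀΔD*·G = NᵀD*`).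
2. §2 (3.151)–(3.152) AS OPERATOR IDENTITIES, for ANY bond form `K`: `eq_3151_op` (`RD*G = Δ𝒢D*` — the type of [g13's]
   `h3151`), `eq_3152` (`RD*G = RG′D* ∧ GDR = DG′R`), `eq_p425_RDGDR` (`RD*GDR = R`), `eq_p426_QGDR` (`Q_bGDR = Q_bDG′R =
   D̄(Q′G′R) = 0`, [g13's] `eq_3124_of_3152` BY NAME); for symmetric `K`: `G_transpose`, `sectD_hypotheses` (= [g13's]
   `sectD_hypotheses_of_3151` with `h3151` DISCHARGED: (3.152); `RD*GQ_b* = 0`, `Q_bGDR = 0`; `RD*GDR = R`, `RG′D*DR = R`).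
3. §3 (3.128)–(3.129): `G1inv K C := Ginv (K − 2C)` with `G1inv_eq` (`G₁⁻¹ = Δ_π − 2𝒞_π + DRD* + a·Q_bᵀQ_b`, `𝒞_π = Tᵀ𝒞T`),
   `eq_3128` (the quadratic form of (3.128): `⟨TA,K·TA⟩ − 2⟨TA,𝒞·TA⟩ + ‖RD*A‖² + a‖Q_bA‖²`, using `Q_bTA = Q_bA`),
   `G1inv_posDef` (v1: `G₁⁻¹ > 0` if `K − 2𝒞 + aQ_bᵀQ_b > 0` on ALL bond configurations — STRONGER than the print's input and
   unsatisfiable whenever `K − 2𝒞` kills the gauge modes; kept as a kernel-true statement only) and — **v1.1** —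
   `G1inv_posDef_of_slicePos` / `G1inv_posDef_of_Δa` (`G₁⁻¹ > 0` if `K − 2𝒞 + aQ_bᵀQ_b > 0` on `{RD*A = 0}`, resp. if the
   PRINT-shaped `K − 2𝒞 + DRD* + aQ_bᵀQ_b > 0` — the `Δ_a` of (3.111) p. 417 at the bond form `K − 2𝒞`; *"they are small
   because the configuration J is small"* is what keeps it positive),
   `eq_3129` ((3.129) `H₁B = G₁Q*(QG₁Q*)⁻¹B` and `T·H₁ = H₁` = [this lineage's] `B9SectDFP.eq_3126` at `K − 2𝒞`),
   `eq_3124_G1` (*"the identities (3.129), which hold also for the operator G₁"*, p. 425: (3.124) for `G₁`),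
   `sectD_hypotheses_G1` (item 2 for `G₁`).
4. §4 (3.151) AT MEASURE LEVEL (`G⁻¹` positive definite, e.g. by [this lineage's] `B9SectDFP.Ginv_posDef`): `eq_3151`
   (`∫dA e^{−½⟨A,G⁻¹A⟩+⟨J,A⟩}·RD*A = (∫dA e^{…})·Δ𝒢D*J`), `eq_3151_normalised` (`RD*G·J = Z(J)⁻¹∫dA e^{…}RD*A` and
   `= Δ𝒢D*J`, `Z(J) > 0` by [g13's] `integral_exp_source`), `eq_3151_G1` (the same for `G₁`).
WHAT IT DOES NOT CERTIFY: the MIDDLE members of (3.151) (the Faddeev–Popov insertion `|det(Δ↾_{N(Q′)})|∫δ_R…∫dλ δ(Q′λ)…Δλ`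
and its evaluation — the (3.125)-type route; C-B9-57 (i) remains the locus of that manipulation, whose asserted END identity
is now kernel-certified by the algebraic route); `R = Δ𝒢Δ`, (2.27), `Q′𝒢 = 𝒢Q′* = 0` and the p. 426 chain (already [g13's]
`R_eq_226`, `frakG_eq_227`, `frakG_constraints`, `eq_p426_chain`); (3.146)–(3.150), (3.153), `𝔓² = 𝔓`, `𝔓^{[*]} = 𝔓`
([r1's] `B9.lean` ring theorems, [g13's] §9 — their remaining inputs `hc`-type definitions aside, every HYPOTHESIS they take
is now a theorem here); `𝔊` of (3.148) as a measure; `C^{(2)}`, `H`, `L^jη` themselves (only the matrix `𝒞` of the quadratic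
form `A″ ↦ ⟨HC^{(2)}(A″),J⟩` enters); Theorems 3.12–3.13 (analytic; [r1's] `B9SectDForm` / G-B9-15, G-B9-16); the block-spin
identification of `K`, `D`, `Q_b`, `D̄` and the inputs kept as hypotheses (`hΔ'`, `hQM`, `hNA`, `hTs`, `hD`, `h115`, `hG`/`hpos`).
MODELLING / DIVERGENCE (recorded as D-b09.54): (a) as D-b09.53 (two `Δ`'s: bond form `K` vs site Laplacian `Δ = DᵀD`; real
entries, `*` ↦ `ᵀ`, `Q*aQ ↦ a_b·Q_bᵀQ_b`; `𝒢 ↦ flucCov (Δ*Δ) Q′`; arbitrary finite index types); (b) (3.128)'s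
`−2⟨HC^{(2)}(A″),J⟩`, `A″ = TA`, a quadratic form in `A″` for fixed `J` (`C^{(2)}` is *"a second order term in the expansion
of Q_j(ηA)"*, `H` linear), ↦ `−2·A″ᵀ𝒞A″` with `𝒞 = C : Matrix b b ℝ` its matrix — so `G₁⁻¹ = Ginv (K − 2C)`; (c) (3.151)'s
source term `⟨A,J⟩ ↦ J ⬝ᵥ A`, `Z(J) ↦ ∫dA e^{−½⟨A,G⁻¹A⟩+⟨J,A⟩}` (Lebesgue measure on `b → ℝ`); (d) — v1.1 — the positivity
input for `G₁⁻¹` is `K − 2𝒞 + aQ_bᵀQ_b > 0` on the gauge-fixed hyperplane `{RD*A = 0}` (or the (3.111)-shaped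
`K − 2𝒞 + DRD* + aQ_bᵀQ_b > 0`), never v1's `hKa` on all of `ℝ^b`; every other theorem takes `hpos : (G⁻¹).PosDef` /
`(G₁⁻¹).PosDef` or invertibility directly and is unaffected.
RECORDS: GAPS C-B9-75 (v1), C-B9-76 (v1.1); DIVERGENCE D-b09.54 (v1), D-b09.55 (v1.1).  No `sorry`, no new axioms.

v1.1 (REPAIR + DOCFIX, APPEND-ONLY: every declaration of v1 unchanged in statement and proof; two theorems ADDED in §3, the
wording of header item 3 and of one docstring corrected).  The cross-read of the sibling `B9SectDFP` v1 by a reader outside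
this lineage (recorded in the cell as GAPS C-pv09g9-15, finding F1) observed that `B9SectDFP.Ginv_posDef`'s hypothesis
`(K + ab • (Qbᵀ * Qb)).PosDef` drops the gauge-fixing term of the print's `Δ_a = Δ + DRD* + Q*aQ` ((3.111) p. 417 —
render re-read as an image for v1.1: *"hence the existence of a unique minimum on this hyperplane follows from positive
definiteness of the operator Δ_a"*) and is unsatisfiable whenever `K` kills the gauge modes `Dλ`, `λ ∈ N(Q′)`.  v1's
`G1inv_posDef` (= that theorem at `K − 2𝒞`) inherits the defect; the repair is the same: `G1inv_posDef_of_slicePos`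
(positivity of `K − 2𝒞 + aQ_bᵀQ_b` on `{RD*A = 0}` suffices, since `RD*·TA = 0`) and `G1inv_posDef_of_Δa`, both proved here
from v1 declarations of `B9SectDFP` only (`Ginv_quadForm`, `Ginv_transpose`, `R_Dt_mulVec_tOp`, `tOp_mulVec`). -/

namespace Literature.MathematicalPhysics.QuantumFieldTheory.Balaban1983to89.B9Eq3152

open Matrix MeasureTheory
open scoped Matrix
open Literature.MathematicalPhysics.QuantumFieldTheory.Balaban1983to89.Beta.Composition (kkt blockProp)
open Literature.MathematicalPhysics.QuantumFieldTheory.Balaban1983to89.Beta.CompositionSingular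

/-! ## §1  Pure gauge modes: `G⁻¹·Dλ = DΔλ` for `λ ∈ N(Q′)`, hence `G·DΔN = DN` and `NᵀΔD*·G = NᵀD*` -/

section GaugeModes

variable {n m τ b q : Type*}

/-- `G⁻¹(Dλ) = DΔλ` for `λ = Nz ∈ N(Q′)`: `Δ_π·DN = 0` ([this lineage's] `B9SectDFP.piOp_mul_gauge`), `Q_b·DN = D̄Q′N = 0`
((3.115)) and `DRD*·DN = DR(ΔN) = DΔN` ([g13's] `B9SectECov.R_mul_Δ_mul_kernel`).  No symmetry of `K` or `Δ` is used.
[cite: Balaban1985BackgroundPropagators, (3.122) p.420, (3.119) p.419, (3.115) p.418] -/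
theorem Ginv_mul_gauge [Fintype n] [Fintype m] [Fintype τ] [Fintype b] [Fintype q] [DecidableEq n] [DecidableEq m]
    [DecidableEq b] (K : Matrix b b ℝ) (Δ : Matrix n n ℝ) (Q : Matrix m n ℝ) (a : ℝ)
    (hΔ' : IsUnit (B9H163.Δ' Δ Q a)) (N : Matrix n τ ℝ) (hQN : Q * N = 0) (D : Matrix b n ℝ) (hD : Dᵀ * D = Δ)
    (Qb : Matrix q b ℝ) (Dbar : Matrix q m ℝ) (h115 : Qb * D = Dbar * Q) (ab : ℝ) :
    B9SectDFP.Ginv K Δ Q a D Qb ab * (D * N) = D * (Δ * N) := by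
  have hπ := (B9SectDFP.piOp_mul_gauge K Δ Q a hΔ' N hQN D hD).1
  have hQW : Qb * (D * N) = 0 := by rw [← Matrix.mul_assoc, h115, Matrix.mul_assoc, hQN, Matrix.mul_zero]
  rw [B9SectDFP.Ginv, Matrix.add_mul, Matrix.add_mul, hπ, zero_add, Matrix.smul_mul, Matrix.mul_assoc Qbᵀ, hQW,
    Matrix.mul_zero, smul_zero, add_zero]
  calc D * B9H163.R Δ Q a * Dᵀ * (D * N) = D * (B9H163.R Δ Q a * (Dᵀ * D * N)) := by simp only [Matrix.mul_assoc]
    _ = D * (Δ * N) := by rw [hD, B9SectECov.R_mul_Δ_mul_kernel Δ Q a hΔ' N hQN]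

/-- `G·DΔN = DN` (`G = (G⁻¹)⁻¹`, `G⁻¹` nonsingular): the propagator reproduces the gauge modes from their Laplacians.
[cite: Balaban1985BackgroundPropagators, (3.122) p.420, (3.152) p.426] -/
theorem G_mul_DΔN [Fintype n] [Fintype m] [Fintype τ] [Fintype b] [Fintype q] [DecidableEq n] [DecidableEq m]
    [DecidableEq b] (K : Matrix b b ℝ) (Δ : Matrix n n ℝ) (Q : Matrix m n ℝ) (a : ℝ)
    (hΔ' : IsUnit (B9H163.Δ' Δ Q a)) (N : Matrix n τ ℝ) (hQN : Q * N = 0) (D : Matrix b n ℝ) (hD : Dᵀ * D = Δ)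
    (Qb : Matrix q b ℝ) (Dbar : Matrix q m ℝ) (h115 : Qb * D = Dbar * Q) (ab : ℝ)
    (hG : IsUnit (B9SectDFP.Ginv K Δ Q a D Qb ab).det) :
    (B9SectDFP.Ginv K Δ Q a D Qb ab)⁻¹ * (D * (Δ * N)) = D * N := by
  rw [← Ginv_mul_gauge K Δ Q a hΔ' N hQN D hD Qb Dbar h115 ab, ← Matrix.mul_assoc, Matrix.nonsing_inv_mul _ hG,
    Matrix.one_mul]

/-- The left-handed version `(DN)ᵀ·G⁻¹ = NᵀΔD*` (symmetric `Δ`, so that `Rᵀ = R` — [g13's] `B9SectECov.R_transpose`; no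
symmetry of `K`: `Δ_πᵀ·DN = 0` as well). [cite: Balaban1985BackgroundPropagators, (3.122) p.420, (3.151) p.425] -/
theorem gauge_transpose_mul_Ginv [Fintype n] [Fintype m] [Fintype τ] [Fintype b] [Fintype q] [DecidableEq n]
    [DecidableEq m] [DecidableEq b] (K : Matrix b b ℝ) (Δ : Matrix n n ℝ) (Q : Matrix m n ℝ) (a : ℝ) (hΔ : Δ.IsSymm)
    (hΔ' : IsUnit (B9H163.Δ' Δ Q a)) (N : Matrix n τ ℝ) (hQN : Q * N = 0) (D : Matrix b n ℝ) (hD : Dᵀ * D = Δ)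
    (Qb : Matrix q b ℝ) (Dbar : Matrix q m ℝ) (h115 : Qb * D = Dbar * Q) (ab : ℝ) :
    (D * N)ᵀ * B9SectDFP.Ginv K Δ Q a D Qb ab = Nᵀ * Δ * Dᵀ := by
  have hπ := (B9SectDFP.piOp_mul_gauge K Δ Q a hΔ' N hQN D hD).2
  have hRt := B9SectECov.R_transpose Δ Q a hΔ
  have hQW : Qb * (D * N) = 0 := by rw [← Matrix.mul_assoc, h115, Matrix.mul_assoc, hQN, Matrix.mul_zero]
  have h1 : (D * N)ᵀ * B9SectDFP.piOp K Δ Q a D = 0 := by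
    have h := congrArg Matrix.transpose hπ
    rwa [transpose_mul, transpose_transpose, transpose_zero] at h
  have h2 : (D * N)ᵀ * Qbᵀ = 0 := by rw [← transpose_mul, hQW, transpose_zero]
  have h3 : Nᵀ * Δ * B9H163.R Δ Q a = Nᵀ * Δ := by
    have h := congrArg Matrix.transpose (B9SectECov.R_mul_Δ_mul_kernel Δ Q a hΔ' N hQN)
    rwa [transpose_mul, transpose_mul, hRt, hΔ.eq] at h
  rw [B9SectDFP.Ginv, Matrix.mul_add, Matrix.mul_add, h1, zero_add, Matrix.mul_smul, ← Matrix.mul_assoc _ Qbᵀ Qb, h2,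
    Matrix.zero_mul, smul_zero, add_zero, transpose_mul]
  calc Nᵀ * Dᵀ * (D * B9H163.R Δ Q a * Dᵀ) = Nᵀ * (Dᵀ * D) * B9H163.R Δ Q a * Dᵀ := by
        simp only [Matrix.mul_assoc]
    _ = Nᵀ * Δ * Dᵀ := by rw [hD, h3]

/-- `NᵀΔD*·G = NᵀD*` — the gauge-coordinate slice `τ₀ = NᵀΔD*` of [this lineage's] `B9SectDFP.Ginv_eq_slice` composed with
the propagator is the plain coordinate map `NᵀD*` (cf. [an2's] `Beta.GaugeFixingPropagators.mul_inv_add_weight`: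
`τ(H + τᵀAτ)⁻¹ = A⁻¹(W(τW)⁻¹)ᵀ`, here with `τ₀W = NᵀΔ²N = A⁻¹`, `W = DN`, and WITHOUT its `kkt`-invertibility hypothesis).
[cite: Balaban1985BackgroundPropagators, (3.151)-(3.152) pp.425-426] -/
theorem NtΔDt_mul_G [Fintype n] [Fintype m] [Fintype τ] [Fintype b] [Fintype q] [DecidableEq n] [DecidableEq m]
    [DecidableEq b] (K : Matrix b b ℝ) (Δ : Matrix n n ℝ) (Q : Matrix m n ℝ) (a : ℝ) (hΔ : Δ.IsSymm)
    (hΔ' : IsUnit (B9H163.Δ' Δ Q a)) (N : Matrix n τ ℝ) (hQN : Q * N = 0) (D : Matrix b n ℝ) (hD : Dᵀ * D = Δ)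
    (Qb : Matrix q b ℝ) (Dbar : Matrix q m ℝ) (h115 : Qb * D = Dbar * Q) (ab : ℝ)
    (hG : IsUnit (B9SectDFP.Ginv K Δ Q a D Qb ab).det) :
    Nᵀ * Δ * Dᵀ * (B9SectDFP.Ginv K Δ Q a D Qb ab)⁻¹ = Nᵀ * Dᵀ := by
  rw [← gauge_transpose_mul_Ginv K Δ Q a hΔ hΔ' N hQN D hD Qb Dbar h115 ab, Matrix.mul_assoc,
    Matrix.mul_nonsing_inv _ hG, Matrix.mul_one, transpose_mul]

end GaugeModes

/-! ## §2  (3.151)–(3.152) as operator identities, `RD*GDR = R`, and [g13's] Sect.-D hypothesis bundle discharged -/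

section Eq3152

variable {n m τ b q : Type*}

/-- **(3.151) AS AN OPERATOR IDENTITY: `RD*G = Δ𝒢D*`** — for EVERY bond form `K` — with `𝒢 = flucCov (Δ²) Q′ =
N(NᵀΔ²N)⁻¹Nᵀ` ([an2's] `blocks_eq_kernelBasis`) and `R = ΔN(NᵀΔ²N)⁻¹NᵀΔ` ([g13's] `R_eq_kernelBasis`): both sides equal
`ΔN(NᵀΔ²N)⁻¹·NᵀD*` by §1's `NᵀΔD*·G = NᵀD*`.  This is LITERALLY the type of the hypothesis `h3151` of [g13's]
`B9SectECov.eq_3152_of_3151` / `sectD_hypotheses_of_3151`. [cite: Balaban1985BackgroundPropagators, (3.151) p.425] -/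
theorem eq_3151_op [Fintype n] [Fintype m] [Fintype τ] [Fintype b] [Fintype q] [DecidableEq n] [DecidableEq m]
    [DecidableEq τ] [DecidableEq b] (e : n ≃ τ ⊕ m) (K : Matrix b b ℝ) (Δ : Matrix n n ℝ) (Q : Matrix m n ℝ) (a : ℝ)
    (hΔ : Δ.IsSymm) (hΔ' : IsUnit (B9H163.Δ' Δ Q a)) (N : Matrix n τ ℝ) (hQN : Q * N = 0)
    (hNA : IsUnit (Nᵀ * N).det) (hQM : IsUnit (Q * Qᵀ).det) (hTs : IsUnit (Nᵀ * (Δ * Δ) * N).det)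
    (D : Matrix b n ℝ) (hD : Dᵀ * D = Δ) (Qb : Matrix q b ℝ) (Dbar : Matrix q m ℝ) (h115 : Qb * D = Dbar * Q)
    (ab : ℝ) (hG : IsUnit (B9SectDFP.Ginv K Δ Q a D Qb ab).det) :
    B9H163.R Δ Q a * Dᵀ * (B9SectDFP.Ginv K Δ Q a D Qb ab)⁻¹ = Δ * flucCov (Δ * Δ) Q * Dᵀ := by
  have hR := B9SectECov.R_eq_kernelBasis e Δ Q a hΔ hΔ' N hQN hQM hTs
  have hNG := NtΔDt_mul_G K Δ Q a hΔ hΔ' N hQN D hD Qb Dbar h115 ab hG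
  rw [(blocks_eq_kernelBasis e (Δ * Δ) Q N hQN hNA hQM hTs).1, hR]
  unfold Beta.LogDetHessian.cov
  calc Δ * N * (Nᵀ * (Δ * Δ) * N)⁻¹ * Nᵀ * Δ * Dᵀ * (B9SectDFP.Ginv K Δ Q a D Qb ab)⁻¹
      = Δ * N * (Nᵀ * (Δ * Δ) * N)⁻¹ * (Nᵀ * Δ * Dᵀ * (B9SectDFP.Ginv K Δ Q a D Qb ab)⁻¹) := by
        simp only [Matrix.mul_assoc]
    _ = Δ * (N * (Nᵀ * (Δ * Δ) * N)⁻¹ * Nᵀ) * Dᵀ := by rw [hNG]; simp only [Matrix.mul_assoc]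

/-- **(3.152): `RD*G = RG′D*` and `GDR = DG′R`** — for EVERY bond form `K` — from §1 (`NᵀΔD*·G = NᵀD*`, `G·DΔN = DN`),
`R = ΔN(NᵀΔ²N)⁻¹NᵀΔ` and `G′ΔN = N` ([g13's] `G'_mul_Δ_mul_kernel`; `NᵀΔG′ = Nᵀ` by the symmetry of `G′`, [adv1's]
`B9H163.G'_isSymm`).  The print derives it from (3.151) and the p. 426 chain ([g13's] `eq_3152_of_3151`).
[cite: Balaban1985BackgroundPropagators, (3.152) p.426] -/
theorem eq_3152 [Fintype n] [Fintype m] [Fintype τ] [Fintype b] [Fintype q] [DecidableEq n] [DecidableEq m]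
    [DecidableEq τ] [DecidableEq b] (e : n ≃ τ ⊕ m) (K : Matrix b b ℝ) (Δ : Matrix n n ℝ) (Q : Matrix m n ℝ) (a : ℝ)
    (hΔ : Δ.IsSymm) (hΔ' : IsUnit (B9H163.Δ' Δ Q a)) (N : Matrix n τ ℝ) (hQN : Q * N = 0)
    (hQM : IsUnit (Q * Qᵀ).det) (hTs : IsUnit (Nᵀ * (Δ * Δ) * N).det)
    (D : Matrix b n ℝ) (hD : Dᵀ * D = Δ) (Qb : Matrix q b ℝ) (Dbar : Matrix q m ℝ) (h115 : Qb * D = Dbar * Q)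
    (ab : ℝ) (hG : IsUnit (B9SectDFP.Ginv K Δ Q a D Qb ab).det) :
    B9H163.R Δ Q a * Dᵀ * (B9SectDFP.Ginv K Δ Q a D Qb ab)⁻¹ = B9H163.R Δ Q a * B9H163.G' Δ Q a * Dᵀ ∧
    (B9SectDFP.Ginv K Δ Q a D Qb ab)⁻¹ * D * B9H163.R Δ Q a = D * B9H163.G' Δ Q a * B9H163.R Δ Q a := by
  have hR := B9SectECov.R_eq_kernelBasis e Δ Q a hΔ hΔ' N hQN hQM hTs
  have hNG := NtΔDt_mul_G K Δ Q a hΔ hΔ' N hQN D hD Qb Dbar h115 ab hG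
  have hGN := G_mul_DΔN K Δ Q a hΔ' N hQN D hD Qb Dbar h115 ab hG
  have hGΔN := B9SectECov.G'_mul_Δ_mul_kernel Δ Q a hΔ' N hQN
  have h4 : Nᵀ * Δ * B9H163.G' Δ Q a = Nᵀ := by
    have h := congrArg Matrix.transpose hGΔN
    rwa [transpose_mul, transpose_mul, hΔ.eq, (B9H163.G'_isSymm (Q := Q) (a := a) hΔ).eq] at h
  set G := (B9SectDFP.Ginv K Δ Q a D Qb ab)⁻¹ with hGdef
  set M := Nᵀ * (Δ * Δ) * N with hM
  rw [hR]
  refine ⟨?_, ?_⟩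
  · calc Δ * N * M⁻¹ * Nᵀ * Δ * Dᵀ * G = Δ * N * M⁻¹ * (Nᵀ * Δ * Dᵀ * G) := by simp only [Matrix.mul_assoc]
      _ = Δ * N * M⁻¹ * (Nᵀ * Δ * B9H163.G' Δ Q a) * Dᵀ := by rw [hNG, h4]; simp only [Matrix.mul_assoc]
      _ = Δ * N * M⁻¹ * Nᵀ * Δ * B9H163.G' Δ Q a * Dᵀ := by simp only [Matrix.mul_assoc]
  · calc G * D * (Δ * N * M⁻¹ * Nᵀ * Δ) = G * (D * (Δ * N)) * (M⁻¹ * Nᵀ * Δ) := by simp only [Matrix.mul_assoc]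
      _ = D * (B9H163.G' Δ Q a * (Δ * N)) * (M⁻¹ * Nᵀ * Δ) := by rw [hGN, hGΔN]
      _ = D * B9H163.G' Δ Q a * (Δ * N * M⁻¹ * Nᵀ * Δ) := by simp only [Matrix.mul_assoc]

/-- **p. 425: `RD*GDR = R`** (*"The last can be proved by the same method as used in the proof of (3.124)"*) — here from
(3.152)'s second line and `D*D = Δ` ([g13's] `eq_p425_RDG₁DR` BY NAME, its hypothesis `h152b` discharged by `eq_3152`); the
hypothesis `hR : r * ds * g * d * r = r` of [r1's] `B9.rds_mul_frakP`. [cite: Balaban1985BackgroundPropagators, p.425] -/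
theorem eq_p425_RDGDR [Fintype n] [Fintype m] [Fintype τ] [Fintype b] [Fintype q] [DecidableEq n] [DecidableEq m]
    [DecidableEq τ] [DecidableEq b] (e : n ≃ τ ⊕ m) (K : Matrix b b ℝ) (Δ : Matrix n n ℝ) (Q : Matrix m n ℝ) (a : ℝ)
    (hΔ : Δ.IsSymm) (hΔ' : IsUnit (B9H163.Δ' Δ Q a)) (N : Matrix n τ ℝ) (hQN : Q * N = 0)
    (hQM : IsUnit (Q * Qᵀ).det) (hTs : IsUnit (Nᵀ * (Δ * Δ) * N).det)
    (D : Matrix b n ℝ) (hD : Dᵀ * D = Δ) (Qb : Matrix q b ℝ) (Dbar : Matrix q m ℝ) (h115 : Qb * D = Dbar * Q)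
    (ab : ℝ) (hG : IsUnit (B9SectDFP.Ginv K Δ Q a D Qb ab).det) :
    B9H163.R Δ Q a * Dᵀ * (B9SectDFP.Ginv K Δ Q a D Qb ab)⁻¹ * D * B9H163.R Δ Q a = B9H163.R Δ Q a :=
  B9SectECov.eq_p425_RDG₁DR Δ Q a hΔ' (B9SectECov.isUnit_M' Δ Q a hΔ hΔ' hQM) D hD _
    (eq_3152 e K Δ Q a hΔ hΔ' N hQN hQM hTs D hD Qb Dbar h115 ab hG).2

/-- **p. 426 L9: `QG₁DR = QDG′R = D̄Q′G′R = 0`** — the three printed links ([g13's] `eq_3124_of_3152` BY NAME, `h152b`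
discharged): the hypothesis `h124 : q * g * d * r = 0` of [r1's] `B9.frakP_of_3146` / `q_mul_frakP` / `frakG_3150`, for every
bond form `K`.  (The adjoint member `RD*GQ_b* = 0` for every `K` is [this lineage's] `B9SectDFP.eq_3124`.)
[cite: Balaban1985BackgroundPropagators, p.426 L9, (3.124) p.420] -/
theorem eq_p426_QGDR [Fintype n] [Fintype m] [Fintype τ] [Fintype b] [Fintype q] [DecidableEq n] [DecidableEq m]
    [DecidableEq τ] [DecidableEq b] (e : n ≃ τ ⊕ m) (K : Matrix b b ℝ) (Δ : Matrix n n ℝ) (Q : Matrix m n ℝ) (a : ℝ)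
    (hΔ : Δ.IsSymm) (hΔ' : IsUnit (B9H163.Δ' Δ Q a)) (N : Matrix n τ ℝ) (hQN : Q * N = 0)
    (hQM : IsUnit (Q * Qᵀ).det) (hTs : IsUnit (Nᵀ * (Δ * Δ) * N).det)
    (D : Matrix b n ℝ) (hD : Dᵀ * D = Δ) (Qb : Matrix q b ℝ) (Dbar : Matrix q m ℝ) (h115 : Qb * D = Dbar * Q)
    (ab : ℝ) (hG : IsUnit (B9SectDFP.Ginv K Δ Q a D Qb ab).det) :
    Qb * (B9SectDFP.Ginv K Δ Q a D Qb ab)⁻¹ * D * B9H163.R Δ Q a = Qb * D * B9H163.G' Δ Q a * B9H163.R Δ Q a ∧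
    Qb * D * B9H163.G' Δ Q a * B9H163.R Δ Q a = Dbar * (Q * B9H163.G' Δ Q a * B9H163.R Δ Q a) ∧
    Dbar * (Q * B9H163.G' Δ Q a * B9H163.R Δ Q a) = 0 :=
  B9SectECov.eq_3124_of_3152 Δ Q a (B9SectECov.isUnit_M' Δ Q a hΔ hΔ' hQM) D _ Qb Dbar h115
    (eq_3152 e K Δ Q a hΔ hΔ' N hQN hQM hTs D hD Qb Dbar h115 ab hG).2

/-- `G = (G⁻¹)⁻¹` is symmetric for symmetric `K`, `Δ` ([this lineage's] `B9SectDFP.Ginv_transpose`). [folklore] -/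
theorem G_transpose [Fintype n] [Fintype m] [Fintype b] [Fintype q] [DecidableEq n] [DecidableEq m] [DecidableEq b]
    (K : Matrix b b ℝ) (hK : Kᵀ = K) (Δ : Matrix n n ℝ) (Q : Matrix m n ℝ) (a : ℝ) (hΔ : Δ.IsSymm) (D : Matrix b n ℝ)
    (Qb : Matrix q b ℝ) (ab : ℝ) :
    ((B9SectDFP.Ginv K Δ Q a D Qb ab)⁻¹)ᵀ = (B9SectDFP.Ginv K Δ Q a D Qb ab)⁻¹ := by
  rw [transpose_nonsing_inv, B9SectDFP.Ginv_transpose K hK Δ Q a hΔ D Qb ab]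

/-- **[g13's] SECT.-D HYPOTHESIS BUNDLE, NOW HYPOTHESIS-FREE** — `B9SectECov.sectD_hypotheses_of_3151` with its operator
hypothesis `h3151 : RD*G = Δ𝒢D*` DISCHARGED by `eq_3151_op` and `G` symmetric by `G_transpose` (symmetric `K`): (3.152) both
lines; (3.124) for `G` both members (`RD*GQ_b* = 0`, `Q_bGDR = 0`); `RD*GDR = R` and `RG′D*DR = R` — i.e. every hypothesis
(`h124`, `h124a/b`, `hR`) of [r1's] `B9.frakP_of_3146` / `q_mul_frakP` / `rds_mul_frakP` / `frakG_3150` / `frakG_3153`, for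
the propagator of ANY symmetric bond form in the Sect.-D shape. [cite: Balaban1985BackgroundPropagators, p.425, p.426 L1-9,
(3.151)-(3.152), (3.124) p.420] -/
theorem sectD_hypotheses [Fintype n] [Fintype m] [Fintype τ] [Fintype b] [Fintype q] [DecidableEq n] [DecidableEq m]
    [DecidableEq τ] [DecidableEq b] (e : n ≃ τ ⊕ m) (K : Matrix b b ℝ) (hK : Kᵀ = K) (Δ : Matrix n n ℝ)
    (Q : Matrix m n ℝ) (a : ℝ) (hΔ : Δ.IsSymm) (hΔ' : IsUnit (B9H163.Δ' Δ Q a)) (N : Matrix n τ ℝ) (hQN : Q * N = 0)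
    (hNA : IsUnit (Nᵀ * N).det) (hQM : IsUnit (Q * Qᵀ).det) (hTs : IsUnit (Nᵀ * (Δ * Δ) * N).det)
    (D : Matrix b n ℝ) (hD : Dᵀ * D = Δ) (Qb : Matrix q b ℝ) (Dbar : Matrix q m ℝ) (h115 : Qb * D = Dbar * Q)
    (ab : ℝ) (hG : IsUnit (B9SectDFP.Ginv K Δ Q a D Qb ab).det) :
    (B9H163.R Δ Q a * Dᵀ * (B9SectDFP.Ginv K Δ Q a D Qb ab)⁻¹ = B9H163.R Δ Q a * B9H163.G' Δ Q a * Dᵀ ∧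
      (B9SectDFP.Ginv K Δ Q a D Qb ab)⁻¹ * D * B9H163.R Δ Q a = D * B9H163.G' Δ Q a * B9H163.R Δ Q a) ∧
    (B9H163.R Δ Q a * Dᵀ * (B9SectDFP.Ginv K Δ Q a D Qb ab)⁻¹ * Qbᵀ = 0 ∧
      Qb * (B9SectDFP.Ginv K Δ Q a D Qb ab)⁻¹ * D * B9H163.R Δ Q a = 0) ∧
    (B9H163.R Δ Q a * Dᵀ * (B9SectDFP.Ginv K Δ Q a D Qb ab)⁻¹ * D * B9H163.R Δ Q a = B9H163.R Δ Q a ∧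
      B9H163.R Δ Q a * B9H163.G' Δ Q a * Dᵀ * D * B9H163.R Δ Q a = B9H163.R Δ Q a) :=
  B9SectECov.sectD_hypotheses_of_3151 e Δ Q a hΔ hΔ' N hQN hNA hQM hTs D hD _ (G_transpose K hK Δ Q a hΔ D Qb ab)
    Qb Dbar h115 (eq_3151_op e K Δ Q a hΔ hΔ' N hQN hNA hQM hTs D hD Qb Dbar h115 ab hG)

end Eq3152

/-! ## §3  (3.128)–(3.129): `G₁⁻¹ = Δ_π − 2𝒞_π + DRD* + Q*aQ` is the Sect.-D shape at the bond form `K − 2𝒞` -/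

section G1

variable {n m τ b q : Type*}

/-- `G₁⁻¹` of (3.128): the Sect.-D form at the bond form `K − 2𝒞`, `𝒞` = the matrix of the quadratic form
`A″ ↦ ⟨HC^{(2)}(A″),J⟩` (fixed `J`). [cite: Balaban1985BackgroundPropagators, (3.128) p.421] -/
noncomputable def G1inv [Fintype n] [Fintype m] [Fintype b] [Fintype q] [DecidableEq n] [DecidableEq m] [DecidableEq b]
    (K C : Matrix b b ℝ) (Δ : Matrix n n ℝ) (Q : Matrix m n ℝ) (a : ℝ) (D : Matrix b n ℝ) (Qb : Matrix q b ℝ) (ab : ℝ) :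
    Matrix b b ℝ :=
  B9SectDFP.Ginv (K - (2 : ℝ) • C) Δ Q a D Qb ab

/-- `G₁⁻¹ = Δ_π − 2𝒞_π + DRD* + a·Q_bᵀQ_b` with `𝒞_π := Tᵀ𝒞T` (the first line of (3.128): `⟨HC_π^{(2)}(A),J⟩ = ⟨HC^{(2)}(TA),J⟩`).
[cite: Balaban1985BackgroundPropagators, (3.128) p.421] -/
theorem G1inv_eq [Fintype n] [Fintype m] [Fintype b] [Fintype q] [DecidableEq n] [DecidableEq m] [DecidableEq b]
    (K C : Matrix b b ℝ) (Δ : Matrix n n ℝ) (Q : Matrix m n ℝ) (a : ℝ) (D : Matrix b n ℝ) (Qb : Matrix q b ℝ) (ab : ℝ) :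
    G1inv K C Δ Q a D Qb ab = B9SectDFP.piOp K Δ Q a D - (2 : ℝ) • B9SectDFP.piOp C Δ Q a D +
      D * B9H163.R Δ Q a * Dᵀ + ab • (Qbᵀ * Qb) := by
  rw [G1inv, B9SectDFP.Ginv, B9SectDFP.piOp, B9SectDFP.piOp, B9SectDFP.piOp, Matrix.mul_sub, Matrix.sub_mul,
    Matrix.mul_smul, Matrix.smul_mul]

/-- **(3.128)**, the quadratic form: `⟨A,G₁⁻¹A⟩ = ⟨TA,K·TA⟩ − 2⟨TA,𝒞·TA⟩ + ‖RD*A‖² + a‖Q_bA‖²`, `TA = A − DG′RD*A`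
(`a‖Q_bTA‖² = a‖Q_bA‖²` by [this lineage's] `B9SectDFP.Qb_mulVec_tOp`, `⟨A,DRD*A⟩ = ‖RD*A‖²` by `Ginv_quadForm`).
[cite: Balaban1985BackgroundPropagators, (3.128) p.421] -/
theorem eq_3128 [Fintype n] [Fintype m] [Fintype b] [Fintype q] [DecidableEq n] [DecidableEq m] [DecidableEq b]
    (K C : Matrix b b ℝ) (Δ : Matrix n n ℝ) (Q : Matrix m n ℝ) (a : ℝ) (hΔ : Δ.IsSymm)
    (hM' : IsUnit (B9H163.M' Δ Q a)) (D : Matrix b n ℝ) (Qb : Matrix q b ℝ) (Dbar : Matrix q m ℝ)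
    (h115 : Qb * D = Dbar * Q) (ab : ℝ) (A : b → ℝ) :
    A ⬝ᵥ G1inv K C Δ Q a D Qb ab *ᵥ A =
      (B9SectDFP.tOp Δ Q a D *ᵥ A) ⬝ᵥ K *ᵥ (B9SectDFP.tOp Δ Q a D *ᵥ A)
        - 2 * ((B9SectDFP.tOp Δ Q a D *ᵥ A) ⬝ᵥ C *ᵥ (B9SectDFP.tOp Δ Q a D *ᵥ A))
        + (B9H163.R Δ Q a *ᵥ (Dᵀ *ᵥ A)) ⬝ᵥ (B9H163.R Δ Q a *ᵥ (Dᵀ *ᵥ A))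
        + ab * ((Qb *ᵥ A) ⬝ᵥ (Qb *ᵥ A)) := by
  rw [G1inv, B9SectDFP.Ginv_quadForm (K - (2 : ℝ) • C) Δ Q a hΔ hM' D Qb Dbar h115 ab A, add_mulVec, dotProduct_add,
    sub_mulVec, dotProduct_sub, Matrix.smul_mulVec, dotProduct_smul, Matrix.smul_mulVec, dotProduct_smul,
    Beta.GaussianIntegral.dotProduct_transpose_mul_self_mulVec, B9SectDFP.Qb_mulVec_tOp Δ Q a hM' D Qb Dbar h115,
    smul_eq_mul, smul_eq_mul]
  ring

/-- v1 (KEPT; superseded by `G1inv_posDef_of_slicePos` / `G1inv_posDef_of_Δa` below — v1.1): `G₁⁻¹ > 0` IF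
`K − 2𝒞 + aQ_bᵀQ_b > 0` on ALL bond configurations — [this lineage's] `B9SectDFP.Ginv_posDef` at `K − 2𝒞`.  Kernel-true, but
the hypothesis is STRONGER than the print's positivity input (the `Δ_a`-shaped `K − 2𝒞 + DRD* + aQ_bᵀQ_b`, (3.111) p. 417 at
the bond form of (3.128)) and unsatisfiable whenever `K − 2𝒞` kills the gauge modes `Dλ`, `λ ∈ N(Q′)` (cross-read finding
F1 on the sibling file, GAPS C-pv09g9-15).  Do not instantiate at Bałaban's operators; use the v1.1 theorems.
[cite: Balaban1985BackgroundPropagators, (3.128) p.421] -/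
theorem G1inv_posDef [Fintype n] [Fintype m] [Fintype b] [Fintype q] [DecidableEq n] [DecidableEq m] [DecidableEq b]
    (K C : Matrix b b ℝ) (hK : Kᵀ = K) (hC : Cᵀ = C) (Δ : Matrix n n ℝ) (Q : Matrix m n ℝ) (a : ℝ) (hΔ : Δ.IsSymm)
    (hM' : IsUnit (B9H163.M' Δ Q a)) (D : Matrix b n ℝ) (Qb : Matrix q b ℝ) (Dbar : Matrix q m ℝ)
    (h115 : Qb * D = Dbar * Q) (ab : ℝ) (hKa : (K - (2 : ℝ) • C + ab • (Qbᵀ * Qb)).PosDef) :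
    (G1inv K C Δ Q a D Qb ab).PosDef :=
  B9SectDFP.Ginv_posDef (K - (2 : ℝ) • C) (by rw [transpose_sub, transpose_smul, hK, hC]) Δ Q a hΔ hM' D Qb Dbar
    h115 ab hKa

/-- **v1.1 — `G₁⁻¹ > 0` FROM THE MINIMAL INPUT**: if `K − 2𝒞 + aQ_bᵀQ_b` is positive on the gauge-fixed hyperplane
`{A : RD*A = 0}` (the smallness of `𝒞 = 𝒞_J` — *"they are small because the configuration J is small"*, p. 421 — keeping
the positivity the print has there by (3.111)/Theorem 3.11), then `G₁⁻¹` of (3.128) is positive definite, EXACTLY: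
`⟨A, G₁⁻¹A⟩ = ⟨TA,(K − 2𝒞 + aQ_bᵀQ_b)TA⟩ + ‖RD*A‖²` ([this lineage's] `B9SectDFP.Ginv_quadForm` at `K − 2𝒞`), `RD*·TA = 0`
(`B9SectDFP.R_Dt_mulVec_tOp`), `A = TA + DG′(RD*A)` (`B9SectDFP.tOp_mulVec`).
[cite: Balaban1985BackgroundPropagators, (3.128) p.421, (3.111) p.417] -/
theorem G1inv_posDef_of_slicePos [Fintype n] [Fintype m] [Fintype b] [Fintype q] [DecidableEq n] [DecidableEq m]
    [DecidableEq b] (K C : Matrix b b ℝ) (hK : Kᵀ = K) (hC : Cᵀ = C) (Δ : Matrix n n ℝ) (Q : Matrix m n ℝ) (a : ℝ)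
    (hΔ : Δ.IsSymm) (hΔ' : IsUnit (B9H163.Δ' Δ Q a)) (hM' : IsUnit (B9H163.M' Δ Q a)) (D : Matrix b n ℝ)
    (hD : Dᵀ * D = Δ) (Qb : Matrix q b ℝ) (Dbar : Matrix q m ℝ) (h115 : Qb * D = Dbar * Q) (ab : ℝ)
    (hslice : ∀ A : b → ℝ, B9H163.R Δ Q a *ᵥ (Dᵀ *ᵥ A) = 0 → A ≠ 0 →
      0 < A ⬝ᵥ (K - (2 : ℝ) • C + ab • (Qbᵀ * Qb)) *ᵥ A) :
    (G1inv K C Δ Q a D Qb ab).PosDef := by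
  have hKC : (K - (2 : ℝ) • C)ᵀ = K - (2 : ℝ) • C := by rw [transpose_sub, transpose_smul, hK, hC]
  rw [G1inv]
  refine Matrix.PosDef.of_dotProduct_mulVec_pos ?_ fun x hx => ?_
  · exact Matrix.isHermitian_iff_isSymm.mpr (B9SectDFP.Ginv_transpose (K - (2 : ℝ) • C) hKC Δ Q a hΔ D Qb ab)
  · rw [star_trivial, B9SectDFP.Ginv_quadForm (K - (2 : ℝ) • C) Δ Q a hΔ hM' D Qb Dbar h115 ab x]
    have h2 : 0 ≤ (B9H163.R Δ Q a *ᵥ (Dᵀ *ᵥ x)) ⬝ᵥ (B9H163.R Δ Q a *ᵥ (Dᵀ *ᵥ x)) :=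
      Finset.sum_nonneg fun j _ => mul_self_nonneg _
    by_cases hT : B9SectDFP.tOp Δ Q a D *ᵥ x = 0
    · have hR : B9H163.R Δ Q a *ᵥ (Dᵀ *ᵥ x) ≠ 0 := by
        intro hR
        apply hx
        have hx' := B9SectDFP.tOp_mulVec Δ Q a D x
        rw [hT, hR, mulVec_zero, mulVec_zero, sub_zero] at hx'
        exact hx'.symm
      have h2' : 0 < (B9H163.R Δ Q a *ᵥ (Dᵀ *ᵥ x)) ⬝ᵥ (B9H163.R Δ Q a *ᵥ (Dᵀ *ᵥ x)) :=
        lt_of_le_of_ne h2 (fun h => hR (dotProduct_self_eq_zero.mp h.symm))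
      rw [hT, zero_dotProduct, zero_add]
      exact h2'
    · exact add_pos_of_pos_of_nonneg (hslice _ (B9SectDFP.R_Dt_mulVec_tOp Δ Q a hΔ' hM' D hD x) hT) h2

/-- **v1.1 — `G₁⁻¹ > 0` FROM THE `Δ_a`-SHAPED INPUT** `K − 2𝒞 + DRD* + aQ_bᵀQ_b > 0` (the operator of (3.111), p. 417,
at the bond form `K − 2𝒞` of (3.128); the repair named by the cross-read of the sibling file, GAPS C-pv09g9-15):
`(DRD*)A = D·R(D*A) = 0` on `{RD*A = 0}`, so this gives `G1inv_posDef_of_slicePos`'s hypothesis.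
[cite: Balaban1985BackgroundPropagators, (3.128) p.421, (3.111) p.417] -/
theorem G1inv_posDef_of_Δa [Fintype n] [Fintype m] [Fintype b] [Fintype q] [DecidableEq n] [DecidableEq m]
    [DecidableEq b] (K C : Matrix b b ℝ) (hK : Kᵀ = K) (hC : Cᵀ = C) (Δ : Matrix n n ℝ) (Q : Matrix m n ℝ) (a : ℝ)
    (hΔ : Δ.IsSymm) (hΔ' : IsUnit (B9H163.Δ' Δ Q a)) (hM' : IsUnit (B9H163.M' Δ Q a)) (D : Matrix b n ℝ)
    (hD : Dᵀ * D = Δ) (Qb : Matrix q b ℝ) (Dbar : Matrix q m ℝ) (h115 : Qb * D = Dbar * Q) (ab : ℝ)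
    (hΔa : (K - (2 : ℝ) • C + D * B9H163.R Δ Q a * Dᵀ + ab • (Qbᵀ * Qb)).PosDef) :
    (G1inv K C Δ Q a D Qb ab).PosDef := by
  refine G1inv_posDef_of_slicePos K C hK hC Δ Q a hΔ hΔ' hM' D hD Qb Dbar h115 ab fun A hRA hA => ?_
  have h1 := hΔa.dotProduct_mulVec_pos hA
  have hz : (D * B9H163.R Δ Q a * Dᵀ) *ᵥ A = 0 := by
    rw [← mulVec_mulVec, ← mulVec_mulVec, hRA, mulVec_zero]
  rw [star_trivial, add_mulVec, add_mulVec, dotProduct_add, dotProduct_add, hz, dotProduct_zero, add_zero,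
    ← dotProduct_add, ← add_mulVec] at h1
  exact h1

/-- **(3.129): `H₁B = G₁Q*(QG₁Q*)⁻¹B`** (*"we repeat the calculations in (3.121)–(3.125)"*) — [this lineage's]
`B9SectDFP.eq_3126` at the bond form `K − 2𝒞`: the `T`-correction of the (3.123)-type mean vanishes (`T·ℋ₁ = ℋ₁`) and the
constrained minimiser `ℋ₁ = minOp G₁⁻¹ Q_b` IS `G₁Q_b*(Q_bG₁Q_b*)⁻¹`. [cite: Balaban1985BackgroundPropagators, (3.129) p.421] -/
theorem eq_3129 [Fintype n] [Fintype m] [Fintype τ] [Fintype b] [Fintype q] [DecidableEq n] [DecidableEq m]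
    [DecidableEq τ] [DecidableEq b] [DecidableEq q] (e : n ≃ τ ⊕ m) (K C : Matrix b b ℝ) (Δ : Matrix n n ℝ)
    (Q : Matrix m n ℝ) (a : ℝ) (hΔ : Δ.IsSymm) (hΔ' : IsUnit (B9H163.Δ' Δ Q a)) (N : Matrix n τ ℝ) (hQN : Q * N = 0)
    (hQM : IsUnit (Q * Qᵀ).det) (hTs : IsUnit (Nᵀ * (Δ * Δ) * N).det) (D : Matrix b n ℝ) (hD : Dᵀ * D = Δ)
    (Qb : Matrix q b ℝ) (Dbar : Matrix q m ℝ) (h115 : Qb * D = Dbar * Q) (ab : ℝ)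
    (hG : IsUnit (G1inv K C Δ Q a D Qb ab).det) (hP : IsUnit (Qb * (G1inv K C Δ Q a D Qb ab)⁻¹ * Qbᵀ).det)
    (B : q → ℝ) :
    B9SectDFP.tOp Δ Q a D *ᵥ (minOp (G1inv K C Δ Q a D Qb ab) Qb *ᵥ B) = minOp (G1inv K C Δ Q a D Qb ab) Qb *ᵥ B ∧
    minOp (G1inv K C Δ Q a D Qb ab) Qb *ᵥ B =
      (G1inv K C Δ Q a D Qb ab)⁻¹ *ᵥ (Qbᵀ *ᵥ ((Qb * (G1inv K C Δ Q a D Qb ab)⁻¹ * Qbᵀ)⁻¹ *ᵥ B)) :=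
  B9SectDFP.eq_3126 e (K - (2 : ℝ) • C) Δ Q a hΔ hΔ' N hQN hQM hTs D hD Qb Dbar h115 ab hG hP B

/-- **p. 425: *"The last term vanishes by the identities (3.129), which hold also for the operator G₁"*** — the last
term of (3.146) is `G₁Q*(QG₁Q*)⁻¹QG₁DRD*A₀`, and what makes it vanish is (3.124)'s `QG₁DR = 0` for `G₁` (the printed
"(3.129)" is read as "(3.124)"): `RD*G₁Q_b* = 0` and `Q_bG₁DR = 0`, [this lineage's] `B9SectDFP.eq_3124` at the bond form
`K − 2𝒞`, for ANY `K`, `𝒞`. [cite: Balaban1985BackgroundPropagators, (3.124) p.420, (3.146) p.425] -/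
theorem eq_3124_G1 [Fintype n] [Fintype m] [Fintype τ] [Fintype b] [Fintype q] [DecidableEq n] [DecidableEq m]
    [DecidableEq τ] [DecidableEq b] [DecidableEq q] (e : n ≃ τ ⊕ m) (K C : Matrix b b ℝ) (Δ : Matrix n n ℝ)
    (Q : Matrix m n ℝ) (a : ℝ) (hΔ : Δ.IsSymm) (hΔ' : IsUnit (B9H163.Δ' Δ Q a)) (N : Matrix n τ ℝ) (hQN : Q * N = 0)
    (hQM : IsUnit (Q * Qᵀ).det) (hTs : IsUnit (Nᵀ * (Δ * Δ) * N).det) (D : Matrix b n ℝ) (hD : Dᵀ * D = Δ)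
    (Qb : Matrix q b ℝ) (Dbar : Matrix q m ℝ) (h115 : Qb * D = Dbar * Q) (ab : ℝ)
    (hG : IsUnit (G1inv K C Δ Q a D Qb ab).det) :
    B9H163.R Δ Q a * Dᵀ * (G1inv K C Δ Q a D Qb ab)⁻¹ * Qbᵀ = 0 ∧
    Qb * (G1inv K C Δ Q a D Qb ab)⁻¹ * (D * B9H163.R Δ Q a) = 0 :=
  B9SectDFP.eq_3124 e (K - (2 : ℝ) • C) Δ Q a hΔ hΔ' N hQN hQM hTs D hD Qb Dbar h115 ab hG

/-- §2's hypothesis-free bundle for `G₁` (symmetric `K`, `𝒞`): (3.152) for `G₁`, (3.124) for `G₁`, `RD*G₁DR = R`,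
`RG′D*DR = R` — every hypothesis of [r1's] `B9.lean` Sect. D / Sect. E ring algebra about `G₁`.
[cite: Balaban1985BackgroundPropagators, (3.152) p.426, p.425] -/
theorem sectD_hypotheses_G1 [Fintype n] [Fintype m] [Fintype τ] [Fintype b] [Fintype q] [DecidableEq n] [DecidableEq m]
    [DecidableEq τ] [DecidableEq b] (e : n ≃ τ ⊕ m) (K C : Matrix b b ℝ) (hK : Kᵀ = K) (hC : Cᵀ = C) (Δ : Matrix n n ℝ)
    (Q : Matrix m n ℝ) (a : ℝ) (hΔ : Δ.IsSymm) (hΔ' : IsUnit (B9H163.Δ' Δ Q a)) (N : Matrix n τ ℝ) (hQN : Q * N = 0)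
    (hNA : IsUnit (Nᵀ * N).det) (hQM : IsUnit (Q * Qᵀ).det) (hTs : IsUnit (Nᵀ * (Δ * Δ) * N).det)
    (D : Matrix b n ℝ) (hD : Dᵀ * D = Δ) (Qb : Matrix q b ℝ) (Dbar : Matrix q m ℝ) (h115 : Qb * D = Dbar * Q)
    (ab : ℝ) (hG : IsUnit (G1inv K C Δ Q a D Qb ab).det) :
    (B9H163.R Δ Q a * Dᵀ * (G1inv K C Δ Q a D Qb ab)⁻¹ = B9H163.R Δ Q a * B9H163.G' Δ Q a * Dᵀ ∧
      (G1inv K C Δ Q a D Qb ab)⁻¹ * D * B9H163.R Δ Q a = D * B9H163.G' Δ Q a * B9H163.R Δ Q a) ∧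
    (B9H163.R Δ Q a * Dᵀ * (G1inv K C Δ Q a D Qb ab)⁻¹ * Qbᵀ = 0 ∧
      Qb * (G1inv K C Δ Q a D Qb ab)⁻¹ * D * B9H163.R Δ Q a = 0) ∧
    (B9H163.R Δ Q a * Dᵀ * (G1inv K C Δ Q a D Qb ab)⁻¹ * D * B9H163.R Δ Q a = B9H163.R Δ Q a ∧
      B9H163.R Δ Q a * B9H163.G' Δ Q a * Dᵀ * D * B9H163.R Δ Q a = B9H163.R Δ Q a) :=
  sectD_hypotheses e (K - (2 : ℝ) • C) (by rw [transpose_sub, transpose_smul, hK, hC]) Δ Q a hΔ hΔ' N hQN hNA hQM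
    hTs D hD Qb Dbar h115 ab hG

end G1

/-! ## §4  (3.151) at the measure level: the `RD*`-moment of the tilted `G⁻¹`-Gaussian -/

section Measure

variable {n m τ b q : Type*}

/-- **(3.151), first and last members**: `∫dA e^{−½⟨A,G⁻¹A⟩ + ⟨J,A⟩}·RD*A = (∫dA e^{−½⟨A,G⁻¹A⟩ + ⟨J,A⟩})·Δ𝒢D*J` — the
tilted-Gaussian mean is `GJ` ([g13's] `B9SectECov.integral_exp_source_smul`, a continuous linear map commuting with the
Bochner integral), then §2's `RD*G = Δ𝒢D*`.  `G⁻¹` positive definite (e.g. [this lineage's] `B9SectDFP.Ginv_posDef`).  The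
middle members of (3.151) (the Faddeev–Popov insertion) are not reproduced. [cite: Balaban1985BackgroundPropagators,
(3.151) p.425] -/
theorem eq_3151 [Fintype n] [Fintype m] [Fintype τ] [Fintype b] [Fintype q] [DecidableEq n] [DecidableEq m]
    [DecidableEq τ] [DecidableEq b] (e : n ≃ τ ⊕ m) (K : Matrix b b ℝ) (Δ : Matrix n n ℝ) (Q : Matrix m n ℝ) (a : ℝ)
    (hΔ : Δ.IsSymm) (hΔ' : IsUnit (B9H163.Δ' Δ Q a)) (N : Matrix n τ ℝ) (hQN : Q * N = 0)
    (hNA : IsUnit (Nᵀ * N).det) (hQM : IsUnit (Q * Qᵀ).det) (hTs : IsUnit (Nᵀ * (Δ * Δ) * N).det)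
    (D : Matrix b n ℝ) (hD : Dᵀ * D = Δ) (Qb : Matrix q b ℝ) (Dbar : Matrix q m ℝ) (h115 : Qb * D = Dbar * Q)
    (ab : ℝ) (hpos : (B9SectDFP.Ginv K Δ Q a D Qb ab).PosDef) (J : b → ℝ) :
    ∫ A : b → ℝ, Real.exp (-(1/2 : ℝ) * (A ⬝ᵥ B9SectDFP.Ginv K Δ Q a D Qb ab *ᵥ A) + J ⬝ᵥ A) •
        (B9H163.R Δ Q a *ᵥ (Dᵀ *ᵥ A)) =
      (∫ A : b → ℝ, Real.exp (-(1/2 : ℝ) * (A ⬝ᵥ B9SectDFP.Ginv K Δ Q a D Qb ab *ᵥ A) + J ⬝ᵥ A)) •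
        (Δ *ᵥ (flucCov (Δ * Δ) Q *ᵥ (Dᵀ *ᵥ J))) := by
  have hG : IsUnit (B9SectDFP.Ginv K Δ Q a D Qb ab).det := (Matrix.isUnit_iff_isUnit_det _).mp hpos.isUnit
  set L : (b → ℝ) →L[ℝ] (n → ℝ) := LinearMap.toContinuousLinearMap (Matrix.mulVecLin (B9H163.R Δ Q a * Dᵀ)) with hL
  have hLx : ∀ x : b → ℝ, (B9H163.R Δ Q a * Dᵀ) *ᵥ x = L x := fun x => rfl
  have hint := B9SectECov.integrable_exp_source_smul (B9SectDFP.Ginv K Δ Q a D Qb ab) hpos J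
  have hcomp : (fun A : b → ℝ => Real.exp (-(1/2 : ℝ) * (A ⬝ᵥ B9SectDFP.Ginv K Δ Q a D Qb ab *ᵥ A) + J ⬝ᵥ A) •
      (B9H163.R Δ Q a *ᵥ (Dᵀ *ᵥ A))) = fun A => L (Real.exp (-(1/2 : ℝ) *
        (A ⬝ᵥ B9SectDFP.Ginv K Δ Q a D Qb ab *ᵥ A) + J ⬝ᵥ A) • A) := by
    funext A
    rw [map_smul, ← hLx, mulVec_mulVec]
  have key : (B9H163.R Δ Q a * Dᵀ) *ᵥ ((B9SectDFP.Ginv K Δ Q a D Qb ab)⁻¹ *ᵥ J) =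
      Δ *ᵥ (flucCov (Δ * Δ) Q *ᵥ (Dᵀ *ᵥ J)) := by
    rw [mulVec_mulVec, eq_3151_op e K Δ Q a hΔ hΔ' N hQN hNA hQM hTs D hD Qb Dbar h115 ab hG]
    simp only [← mulVec_mulVec]
  rw [hcomp, ContinuousLinearMap.integral_comp_comm L hint, B9SectECov.integral_exp_source_smul _ hpos J, map_smul,
    ← hLx, key]

/-- **(3.151) AS PRINTED**: `RD*G·J = Z(J)⁻¹∫dA e^{−½⟨A,G⁻¹A⟩ + ⟨J,A⟩}RD*A` (the normalised mean; `Z(J) > 0` by [g13's]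
`integral_exp_source`, `gaussNorm_pos`) and `RD*G·J = Δ𝒢D*J`. [cite: Balaban1985BackgroundPropagators, (3.151) p.425] -/
theorem eq_3151_normalised [Fintype n] [Fintype m] [Fintype τ] [Fintype b] [Fintype q] [DecidableEq n] [DecidableEq m]
    [DecidableEq τ] [DecidableEq b] (e : n ≃ τ ⊕ m) (K : Matrix b b ℝ) (Δ : Matrix n n ℝ) (Q : Matrix m n ℝ) (a : ℝ)
    (hΔ : Δ.IsSymm) (hΔ' : IsUnit (B9H163.Δ' Δ Q a)) (N : Matrix n τ ℝ) (hQN : Q * N = 0)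
    (hNA : IsUnit (Nᵀ * N).det) (hQM : IsUnit (Q * Qᵀ).det) (hTs : IsUnit (Nᵀ * (Δ * Δ) * N).det)
    (D : Matrix b n ℝ) (hD : Dᵀ * D = Δ) (Qb : Matrix q b ℝ) (Dbar : Matrix q m ℝ) (h115 : Qb * D = Dbar * Q)
    (ab : ℝ) (hpos : (B9SectDFP.Ginv K Δ Q a D Qb ab).PosDef) (J : b → ℝ) :
    (B9H163.R Δ Q a * Dᵀ * (B9SectDFP.Ginv K Δ Q a D Qb ab)⁻¹) *ᵥ J =
      (∫ A : b → ℝ, Real.exp (-(1/2 : ℝ) * (A ⬝ᵥ B9SectDFP.Ginv K Δ Q a D Qb ab *ᵥ A) + J ⬝ᵥ A))⁻¹ •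
        ∫ A : b → ℝ, Real.exp (-(1/2 : ℝ) * (A ⬝ᵥ B9SectDFP.Ginv K Δ Q a D Qb ab *ᵥ A) + J ⬝ᵥ A) •
          (B9H163.R Δ Q a *ᵥ (Dᵀ *ᵥ A)) ∧
    (B9H163.R Δ Q a * Dᵀ * (B9SectDFP.Ginv K Δ Q a D Qb ab)⁻¹) *ᵥ J = (Δ * flucCov (Δ * Δ) Q * Dᵀ) *ᵥ J := by
  have hG : IsUnit (B9SectDFP.Ginv K Δ Q a D Qb ab).det := (Matrix.isUnit_iff_isUnit_det _).mp hpos.isUnit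
  have hZ : 0 < ∫ A : b → ℝ, Real.exp (-(1/2 : ℝ) * (A ⬝ᵥ B9SectDFP.Ginv K Δ Q a D Qb ab *ᵥ A) + J ⬝ᵥ A) := by
    rw [B9SectECov.integral_exp_source _ hpos J]
    exact mul_pos (Real.exp_pos _) (B9SectECov.gaussNorm_pos hpos)
  have hop := eq_3151_op e K Δ Q a hΔ hΔ' N hQN hNA hQM hTs D hD Qb Dbar h115 ab hG
  refine ⟨?_, by rw [hop]⟩
  rw [eq_3151 e K Δ Q a hΔ hΔ' N hQN hNA hQM hTs D hD Qb Dbar h115 ab hpos J, smul_smul, inv_mul_cancel₀ hZ.ne',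
    one_smul, hop]
  simp only [← mulVec_mulVec]

/-- (3.151) for `G₁` of (3.128) — the operator the print states it for — as the instance `K ↦ K − 2𝒞` of `eq_3151`.
[cite: Balaban1985BackgroundPropagators, (3.151) p.425, (3.128) p.421] -/
theorem eq_3151_G1 [Fintype n] [Fintype m] [Fintype τ] [Fintype b] [Fintype q] [DecidableEq n] [DecidableEq m]
    [DecidableEq τ] [DecidableEq b] (e : n ≃ τ ⊕ m) (K C : Matrix b b ℝ) (Δ : Matrix n n ℝ) (Q : Matrix m n ℝ)
    (a : ℝ) (hΔ : Δ.IsSymm) (hΔ' : IsUnit (B9H163.Δ' Δ Q a)) (N : Matrix n τ ℝ) (hQN : Q * N = 0)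
    (hNA : IsUnit (Nᵀ * N).det) (hQM : IsUnit (Q * Qᵀ).det) (hTs : IsUnit (Nᵀ * (Δ * Δ) * N).det)
    (D : Matrix b n ℝ) (hD : Dᵀ * D = Δ) (Qb : Matrix q b ℝ) (Dbar : Matrix q m ℝ) (h115 : Qb * D = Dbar * Q)
    (ab : ℝ) (hpos : (G1inv K C Δ Q a D Qb ab).PosDef) (J : b → ℝ) :
    ∫ A : b → ℝ, Real.exp (-(1/2 : ℝ) * (A ⬝ᵥ G1inv K C Δ Q a D Qb ab *ᵥ A) + J ⬝ᵥ A) •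
        (B9H163.R Δ Q a *ᵥ (Dᵀ *ᵥ A)) =
      (∫ A : b → ℝ, Real.exp (-(1/2 : ℝ) * (A ⬝ᵥ G1inv K C Δ Q a D Qb ab *ᵥ A) + J ⬝ᵥ A)) •
        (Δ *ᵥ (flucCov (Δ * Δ) Q *ᵥ (Dᵀ *ᵥ J))) :=
  eq_3151 e (K - (2 : ℝ) • C) Δ Q a hΔ hΔ' N hQN hNA hQM hTs D hD Qb Dbar h115 ab hpos J

end Measure

end Literature.MathematicalPhysics.QuantumFieldTheory.Balaban1983to89.B9Eq3152
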